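import Summits.KontsevichZagierPeriods.KontsevichZagierPeriods.Theorems.RootDecompWalshStrataSplit4PiRung
import HarnessLib

/-!
# Root decomposition / Walsh strata — the `ℚ̄`-scaled `π`-sector `Π^alg` and its kernel theorem

Generation 12, part 100 of the node `QuadricSignKernel` (route `RootDecompWalshStrata`).

Parts 93–99 decided Conjecture 1 in kernel form for mixed families drawn from the orbits of the four
uncut `d = 4` specimens (ball, split quadric, paraboloid, cone) over the RATIONAL `π`-sector
`Π = ⟨[pt,a], [(0,1), b/(1+t²)], [(0,1)², c/((1+x²)(1+y²))] : a b c ∈ ℚ⟩` (`PiSector.piKernel`).  This file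
widens the sector to REAL-ALGEBRAIC weights `a b c ∈ ℚ̄ ∩ ℝ` — Kontsevich–Zagier allow algebraic
coefficients [KontsevichZagier2001 §1.1], and the tree's `KZ.IntegralRep.constMul` multiplies an
integrand by a real algebraic constant — and proves:

* `algCoeffs_eq_zero` — `a + b·π/4 + c·π²/16 = 0` with `a, b, c` real algebraic forces `a = b = c = 0`
  (`π` is transcendental over `ℚ`, hence over the algebraic closure of `ℚ` in `ℝ`:
  Mathlib's `Transcendental.subalgebraAlgebraicClosure` on the tree's `transcendental_pi_holds`);
* `algKernel` — **Conjecture 1 in kernel form on the algebraic `π`-sector `Π^alg`, PROVED**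
  (normal form inside the rules + Lindemann over `ℚ̄`);
* `pi_bridge`, `algDescentAt_of_piDescentAt` — the rational sector embeds (`Π ⊆ Π^alg` modulo
  relations), so the four genera of parts 95–98 are in the `Π^alg`-class (`algDescentAt_ball4/parab4/cone4`,
  `algDescentAt_split4_of_eulerKZ`);
* `sum_mem_relations_alg` — the mechanism on `Π^alg`: a vanishing `ℤ`-combination of constant-weight
  quadric cells all in the `Π^alg`-class is a relation, NO ORACLE.

The point of the widening (used in part 101, `RootDecompWalshStrataEllipsoid4`): the ellipsoid orthants
`Σaᵢxᵢ² < 1` have values `qπ²/(32√(a₀a₁a₂a₃))` spanning infinitely many `ℚ`-lines — outside the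
rational sector, inside the algebraic one — and the kernel theorem survives the widening because
Lindemann's theorem is a statement over `ℚ̄`.

References: [KontsevichZagier2001] M. Kontsevich, D. Zagier, *Periods* (2001) §1.1–1.2;
[Lindemann1882] F. Lindemann, *Über die Zahl π*, Math. Ann. 20 (1882); [BakerTNT1975] A. Baker,
*Transcendental Number Theory* (1975) Thm 1.3.
-/

noncomputable section

open Literature.NumberTheory.Transcendental
open MeasureTheory Set
open MvPolynomial (aeval X C rename bind₁)
open Literature.ModelTheory.ExponentialFields (IsSemialgebraic)
open Summit.KontsevichZagierPeriods.RootDecompWalshStrata.WalshSpanProof (cellRep cellRep_domain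
  cellRep_integrand)
open Summit.KontsevichZagierPeriods.RootDecompWalshStrata.QuadricFourRung (totalDegree_ball4Poly_le
  totalDegree_parab4Poly_le totalDegree_cone4Poly_le totalDegree_split4Poly_le)
open Summit.KontsevichZagierPeriods.RootDecompWalshStrata.Ball4 (ball4Poly aeval_ball4Poly)
open Summit.KontsevichZagierPeriods.RootDecompWalshStrata.Parab4 (parab4Poly)
open Summit.KontsevichZagierPeriods.RootDecompWalshStrata.Cone4 (cone4Poly)
open Summit.KontsevichZagierPeriods.RootDecompWalshStrata.Split4 (split4Poly)
open Summit.KontsevichZagierPeriods.RootDecompWalshStrata.PiSector (piGens cstRep hqRep hq2Rep cstRep_integrand hqRep_domain hqRep_integrand hq2Rep_domain hq2Rep_integrand value_hqRep value_hq2Rep mem_relations_of_add_self)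
open Summit.KontsevichZagierPeriods.RootDecompWalshStrata.PiAt (QuadricDescentAt descentAt_of_cellRep
  descentAt_rename descentAt_rename_reflect descentAt_of_bridge sum_mem_relations_of_descentAt
  of_ball4_cell_sub_of_hq2Rep_mem_relations piDescentAt_ball4 piDescentAt_parab4 piDescentAt_cone4
  EulerKZ piDescentAt_split4_of_eulerKZ totalDegree_reflect_le)

namespace Summit.KontsevichZagierPeriods.RootDecompWalshStrata.PiAlg

open Literature.NumberTheory.Transcendental in
open MeasureTheory Set in
open MvPolynomial (aeval X C) in
open Literature.ModelTheory.ExponentialFields (IsSemialgebraic) in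
open Summit.KontsevichZagierPeriods.RootDecompWalshStrata.Ball4 (ivSet isSemialgebraic_ivSet ivSet_subset_Icc) in
open Summit.KontsevichZagierPeriods.KontsevichZagierPeriods.Theorems.RootDecompQuadraticDescentLegendre (I1 measurableSet_I1 setIntegral_I1 integrableOn_I1_of integrableOn_Ioo_of_continuous) in
/-- A rational number is algebraic over `ℚ` (as a real number). [folklore] -/
private theorem isAlgebraic_rat (q : ℚ) : IsAlgebraic ℚ ((q : ℚ) : ℝ) := by
  simpa using isAlgebraic_algebraMap (R := ℚ) (A := ℝ) q

/-! ### The real algebraic numbers -/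

/-- The subalgebra `ℚ̄ ∩ ℝ` of real algebraic numbers (Mathlib's algebraic closure of `ℚ` in `ℝ`).
[definition] -/
abbrev Alg : Subalgebra ℚ ℝ := Subalgebra.algebraicClosure ℚ ℝ

/-- Membership in `Alg` is algebraicity over `ℚ`. [Mathlib `Subalgebra.mem_algebraicClosure`] -/
theorem mem_Alg_iff {x : ℝ} : x ∈ Alg ↔ IsAlgebraic ℚ x := Subalgebra.mem_algebraicClosure ℚ ℝ

/-- An element of `Alg` is algebraic. [definition] -/
theorem isAlgebraic_coe (a : Alg) : IsAlgebraic ℚ (a : ℝ) := mem_Alg_iff.1 a.2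

/-- A rational number as an element of `Alg`. [definition] -/
def ratA (q : ℚ) : Alg := ⟨(q : ℝ), mem_Alg_iff.2 (isAlgebraic_rat q)⟩

/-- The coercion of `ratA q` is `q`. [definition] -/
@[simp] theorem coe_ratA (q : ℚ) : (ratA q : ℝ) = q := rfl

/-! ### The transcendence input over `ℚ̄`: `1, π, π²` are `ℚ̄`-linearly independent -/

/-- **`a + b·π/4 + c·π²/16 = 0` with `a, b, c` real algebraic forces `a = b = c = 0`:** otherwise `π`
is a root of the non-zero polynomial `16a + 4bX + cX² ∈ ℚ̄[X]`, contradicting the transcendence of `π`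
over the algebraic closure of `ℚ` in `ℝ` (Lindemann; Mathlib `Transcendental.subalgebraAlgebraicClosure`).
[Lindemann1882 via BakerTNT1975 Thm 1.3] -/
theorem algCoeffs_eq_zero {a b c : ℝ} (ha : IsAlgebraic ℚ a) (hb : IsAlgebraic ℚ b)
    (hc : IsAlgebraic ℚ c) (h : a + b * (Real.pi / 4) + c * (Real.pi ^ 2 / 16) = 0) :
    a = 0 ∧ b = 0 ∧ c = 0 := by
  by_contra hne
  set a' : Alg := ⟨a, mem_Alg_iff.2 ha⟩ with ha'
  set b' : Alg := ⟨b, mem_Alg_iff.2 hb⟩ with hb'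
  set c' : Alg := ⟨c, mem_Alg_iff.2 hc⟩ with hc'
  have hp : (Polynomial.C (16 * a') + Polynomial.C (4 * b') * Polynomial.X +
      Polynomial.C c' * Polynomial.X ^ 2 : Polynomial Alg) ≠ 0 := by
    intro h0
    have e0 := congrArg (fun p : Polynomial Alg => ((p.coeff 0 : Alg) : ℝ)) h0
    have e1 := congrArg (fun p : Polynomial Alg => ((p.coeff 1 : Alg) : ℝ)) h0
    have e2 := congrArg (fun p : Polynomial Alg => ((p.coeff 2 : Alg) : ℝ)) h0
    simp [Polynomial.coeff_X, Polynomial.coeff_C, Polynomial.coeff_X_pow, ha', hb', hc'] at e0 e1 e2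
    exact hne ⟨e0, e1, e2⟩
  have halg : IsAlgebraic Alg Real.pi := by
    refine ⟨_, hp, ?_⟩
    simp only [map_add, map_mul, map_pow, Polynomial.aeval_C, Polynomial.aeval_X,
      Subalgebra.algebraMap_apply, ha', hb', hc']
    have e16 : ((16 : Alg) : ℝ) = 16 := by norm_cast
    have e4 : ((4 : Alg) : ℝ) = 4 := by norm_cast
    rw [e16, e4]
    linear_combination (16 : ℝ) * h
  exact Transcendental.subalgebraAlgebraicClosure (R := ℚ) transcendental_pi_holds halg

/-! ### The algebraic `π`-sector `Π^alg` -/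

/-- `[pt, a]` with `a` real algebraic. [KontsevichZagier2001 §1.1] -/
def cstA (a : Alg) : KZ.IntegralRep 0 := KZ.IntegralRep.unit.constMul (a : ℝ) (isAlgebraic_coe a)

/-- `[(0,1), b/(1+t²)]` with `b` real algebraic (value `b·π/4`). [KontsevichZagier2001 §1.1] -/
def hqA (b : Alg) : KZ.IntegralRep 1 := (hqRep 1).constMul (b : ℝ) (isAlgebraic_coe b)

/-- `[(0,1)², c/((1+x²)(1+y²))]` with `c` real algebraic (value `c·π²/16`). [KontsevichZagier2001 §1.1] -/
def hq2A (c : Alg) : KZ.IntegralRep 2 := (hq2Rep 1).constMul (c : ℝ) (isAlgebraic_coe c)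

/-- The integrand of `[pt, a]`. [definition] -/
@[simp] theorem cstA_integrand (a : Alg) (x : Fin 0 → ℝ) : (cstA a).integrand x = (a : ℝ) := by
  simp [cstA]

/-- The domain of the algebraic arc generator is `(0,1)`. [definition] -/
@[simp] theorem hqA_domain (b : Alg) : (hqA b).domain = (hqRep 1).domain := rfl

/-- The integrand `b/(1+t²)`. [definition] -/
@[simp] theorem hqA_integrand (b : Alg) (t : Fin 1 → ℝ) :
    (hqA b).integrand t = (b : ℝ) / (1 + t 0 ^ 2) := by
  simp [hqA, hqRep_integrand, div_eq_mul_inv]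

/-- The domain of the algebraic weight-two generator is `(0,1)²`. [definition] -/
@[simp] theorem hq2A_domain (c : Alg) : (hq2A c).domain = (hq2Rep 1).domain := rfl

/-- The integrand `c/((1+x²)(1+y²))`. [definition] -/
@[simp] theorem hq2A_integrand (c : Alg) (z : Fin 2 → ℝ) :
    (hq2A c).integrand z = (c : ℝ) * (1 / (1 + z 0 ^ 2) * (1 / (1 + z 1 ^ 2))) := by
  simp [hq2A, hq2Rep_integrand]

/-- `value [pt, a] = a`. [KontsevichZagier2001 §1.1] -/
theorem value_cstA (a : Alg) : (cstA a).value = a := by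
  rw [cstA, KZ.IntegralRep.value_constMul, KZ.IntegralRep.value_unit, mul_one]

/-- `value [(0,1), b/(1+t²)] = b·π/4`. [KontsevichZagier2001 §1.1] -/
theorem value_hqA (b : Alg) : (hqA b).value = (b : ℝ) * (Real.pi / 4) := by
  rw [hqA, KZ.IntegralRep.value_constMul, value_hqRep, Rat.cast_one, one_mul]

/-- `value [(0,1)², c/((1+x²)(1+y²))] = c·π²/16`. [KontsevichZagier2001 §1.1] -/
theorem value_hq2A (c : Alg) : (hq2A c).value = (c : ℝ) * (Real.pi ^ 2 / 16) := by
  rw [hq2A, KZ.IntegralRep.value_constMul, value_hq2Rep, Rat.cast_one, one_mul]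

/-- Integrand additivity: `[pt, a₁+a₂] − [pt, a₁] − [pt, a₂]` is ONE move. [KontsevichZagier2001 §1.2 rule (1)] -/
theorem of_cstA_add (a₁ a₂ : Alg) :
    KZ.of (cstA (a₁ + a₂)) - KZ.of (cstA a₁) - KZ.of (cstA a₂) ∈ KZ.relations :=
  KZ.integrandAddRel_subset_relations ⟨0, cstA (a₁ + a₂), cstA a₁, cstA a₂, rfl, rfl,
    fun x _ => by simp only [cstA_integrand, Pi.add_apply, Subalgebra.coe_add], rfl⟩

/-- Integrand additivity for the arc generator. [KontsevichZagier2001 §1.2 rule (1)] -/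
theorem of_hqA_add (b₁ b₂ : Alg) :
    KZ.of (hqA (b₁ + b₂)) - KZ.of (hqA b₁) - KZ.of (hqA b₂) ∈ KZ.relations :=
  KZ.integrandAddRel_subset_relations ⟨1, hqA (b₁ + b₂), hqA b₁, hqA b₂, rfl, rfl,
    fun x _ => by simp only [hqA_integrand, Pi.add_apply, Subalgebra.coe_add]; ring, rfl⟩

/-- Integrand additivity for the weight-two generator. [KontsevichZagier2001 §1.2 rule (1)] -/
theorem of_hq2A_add (c₁ c₂ : Alg) :
    KZ.of (hq2A (c₁ + c₂)) - KZ.of (hq2A c₁) - KZ.of (hq2A c₂) ∈ KZ.relations :=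
  KZ.integrandAddRel_subset_relations ⟨2, hq2A (c₁ + c₂), hq2A c₁, hq2A c₂, rfl, rfl,
    fun x _ => by simp only [hq2A_integrand, Pi.add_apply, Subalgebra.coe_add]; ring, rfl⟩

/-- **The algebraic `π`-sector `Π^alg`:** the generators `[pt, a]`, `[(0,1), b/(1+t²)]`,
`[(0,1)², c/((1+x²)(1+y²))]` with `a, b, c` REAL ALGEBRAIC. [KontsevichZagier2001 §1.1; this node] -/
def algGens : Set KZ.FormalRep :=
  (Set.range fun a : Alg => KZ.of (cstA a)) ∪ (Set.range fun b : Alg => KZ.of (hqA b)) ∪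
    (Set.range fun c : Alg => KZ.of (hq2A c))

/-- The normal form on `Π^alg`. [this node] -/
def algNF (a b c : Alg) : KZ.FormalRep := KZ.of (cstA a) + KZ.of (hqA b) + KZ.of (hq2A c)

/-- `[pt, a] ∈ Π^alg`. [definition] -/
theorem of_cstA_mem_algGens (a : Alg) : KZ.of (cstA a) ∈ algGens := Or.inl (Or.inl ⟨a, rfl⟩)

/-- `[(0,1), b/(1+t²)] ∈ Π^alg`. [definition] -/
theorem of_hqA_mem_algGens (b : Alg) : KZ.of (hqA b) ∈ algGens := Or.inl (Or.inr ⟨b, rfl⟩)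

/-- `[(0,1)², c/((1+x²)(1+y²))] ∈ Π^alg`. [definition] -/
theorem of_hq2A_mem_algGens (c : Alg) : KZ.of (hq2A c) ∈ algGens := Or.inr ⟨c, rfl⟩

/-- The normal form lies in the subgroup generated by `Π^alg`. [definition] -/
theorem algNF_mem_closure (a b c : Alg) : algNF a b c ∈ AddSubgroup.closure algGens :=
  add_mem (add_mem (AddSubgroup.subset_closure (of_cstA_mem_algGens a))
    (AddSubgroup.subset_closure (of_hqA_mem_algGens b)))
    (AddSubgroup.subset_closure (of_hq2A_mem_algGens c))

/-- `value` of the normal form: `a + b·π/4 + c·π²/16`. [KontsevichZagier2001 §1.1] -/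
theorem eval_algNF (a b c : Alg) :
    KZ.eval (algNF a b c) = (a : ℝ) + (b : ℝ) * (Real.pi / 4) + (c : ℝ) * (Real.pi ^ 2 / 16) := by
  simp only [algNF, map_add, KZ.eval_of, value_cstA, value_hqA, value_hq2A]

/-- Additivity of the normal form modulo relations. [KontsevichZagier2001 §1.2 rule (1)] -/
theorem algNF_add_sub_mem (a₁ b₁ c₁ a₂ b₂ c₂ : Alg) :
    algNF (a₁ + a₂) (b₁ + b₂) (c₁ + c₂) - (algNF a₁ b₁ c₁ + algNF a₂ b₂ c₂) ∈ KZ.relations := by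
  have : algNF (a₁ + a₂) (b₁ + b₂) (c₁ + c₂) - (algNF a₁ b₁ c₁ + algNF a₂ b₂ c₂) =
      (KZ.of (cstA (a₁ + a₂)) - KZ.of (cstA a₁) - KZ.of (cstA a₂)) +
      (KZ.of (hqA (b₁ + b₂)) - KZ.of (hqA b₁) - KZ.of (hqA b₂)) +
      (KZ.of (hq2A (c₁ + c₂)) - KZ.of (hq2A c₁) - KZ.of (hq2A c₂)) := by
    simp only [algNF]; abel
  rw [this]
  exact add_mem (add_mem (of_cstA_add _ _) (of_hqA_add _ _)) (of_hq2A_add _ _)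

/-- `[pt, 0]` is a relation. [KontsevichZagier2001 §1.2] -/
theorem of_cstA_zero_mem : KZ.of (cstA 0) ∈ KZ.relations :=
  mem_relations_of_add_self (by simpa using of_cstA_add 0 0)

/-- `[(0,1), 0]` is a relation. [KontsevichZagier2001 §1.2] -/
theorem of_hqA_zero_mem : KZ.of (hqA 0) ∈ KZ.relations :=
  mem_relations_of_add_self (by simpa using of_hqA_add 0 0)

/-- `[(0,1)², 0]` is a relation. [KontsevichZagier2001 §1.2] -/
theorem of_hq2A_zero_mem : KZ.of (hq2A 0) ∈ KZ.relations :=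
  mem_relations_of_add_self (by simpa using of_hq2A_add 0 0)

/-- The zero normal form is a relation. [KontsevichZagier2001 §1.2] -/
theorem algNF_zero_mem_relations : algNF 0 0 0 ∈ KZ.relations :=
  add_mem (add_mem of_cstA_zero_mem of_hqA_zero_mem) of_hq2A_zero_mem

/-- Negation of the normal form modulo relations. [KontsevichZagier2001 §1.2 rule (1)] -/
theorem algNF_neg_add_mem (a b c : Alg) : algNF (-a) (-b) (-c) + algNF a b c ∈ KZ.relations := by
  have h := algNF_add_sub_mem (-a) (-b) (-c) a b c
  simp only [neg_add_cancel] at h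
  have : algNF (-a) (-b) (-c) + algNF a b c =
      algNF 0 0 0 - (algNF 0 0 0 - (algNF (-a) (-b) (-c) + algNF a b c)) := by abel
  rw [this]
  exact sub_mem algNF_zero_mem_relations h

/-- **Normal form on `Π^alg`:** every element of the subgroup generated by `algGens` is congruent
modulo relations to some `algNF a b c`. [KontsevichZagier2001 §1.2 rule (1); this node] -/
theorem exists_normalForm {x : KZ.FormalRep} (hx : x ∈ AddSubgroup.closure algGens) :
    ∃ a b c : Alg, x - algNF a b c ∈ KZ.relations := by
  induction hx using AddSubgroup.closure_induction with
  | mem y hy =>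
    rcases hy with (⟨a, rfl⟩ | ⟨b, rfl⟩) | ⟨c, rfl⟩
    · refine ⟨a, 0, 0, ?_⟩
      have e : (fun a : Alg => KZ.of (cstA a)) a - algNF a 0 0 = -(KZ.of (hqA 0) + KZ.of (hq2A 0)) := by
        simp only [algNF]; abel
      rw [e]
      exact neg_mem (add_mem of_hqA_zero_mem of_hq2A_zero_mem)
    · refine ⟨0, b, 0, ?_⟩
      have e : (fun b : Alg => KZ.of (hqA b)) b - algNF 0 b 0 = -(KZ.of (cstA 0) + KZ.of (hq2A 0)) := by
        simp only [algNF]; abel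
      rw [e]
      exact neg_mem (add_mem of_cstA_zero_mem of_hq2A_zero_mem)
    · refine ⟨0, 0, c, ?_⟩
      have e : (fun c : Alg => KZ.of (hq2A c)) c - algNF 0 0 c = -(KZ.of (cstA 0) + KZ.of (hqA 0)) := by
        simp only [algNF]; abel
      rw [e]
      exact neg_mem (add_mem of_cstA_zero_mem of_hqA_zero_mem)
  | zero =>
    exact ⟨0, 0, 0, by simpa using neg_mem algNF_zero_mem_relations⟩
  | add y z _ _ hy hz =>
    obtain ⟨a₁, b₁, c₁, h₁⟩ := hy
    obtain ⟨a₂, b₂, c₂, h₂⟩ := hz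
    refine ⟨a₁ + a₂, b₁ + b₂, c₁ + c₂, ?_⟩
    have : y + z - algNF (a₁ + a₂) (b₁ + b₂) (c₁ + c₂) =
        (y - algNF a₁ b₁ c₁) + (z - algNF a₂ b₂ c₂) -
          (algNF (a₁ + a₂) (b₁ + b₂) (c₁ + c₂) - (algNF a₁ b₁ c₁ + algNF a₂ b₂ c₂)) := by abel
    rw [this]
    exact sub_mem (add_mem h₁ h₂) (algNF_add_sub_mem _ _ _ _ _ _)
  | neg y _ hy =>
    obtain ⟨a, b, c, h⟩ := hy
    refine ⟨-a, -b, -c, ?_⟩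
    have : -y - algNF (-a) (-b) (-c) = -(y - algNF a b c) - (algNF (-a) (-b) (-c) + algNF a b c) := by
      abel
    rw [this]
    exact sub_mem (neg_mem h) (algNF_neg_add_mem a b c)

/-- **`algKernel` — Conjecture 1 in kernel form on the ALGEBRAIC `π`-sector, PROVED:** every
`ℤ`-combination of `[pt, a]`, `[(0,1), b/(1+t²)]`, `[(0,1)², c/((1+x²)(1+y²))]` with real algebraic
`a, b, c` whose value is `0` lies in `KZ.relations`. (Normal form by integrand additivity; `1, π, π²`
are `ℚ̄`-independent by Lindemann; zero weights are relations.)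
[KontsevichZagier2001 §1.2; Lindemann1882; this node] -/
theorem algKernel : ∀ ⦃x : KZ.FormalRep⦄, x ∈ AddSubgroup.closure algGens → KZ.eval x = 0 →
    x ∈ KZ.relations := by
  intro x hx hv
  obtain ⟨a, b, c, h⟩ := exists_normalForm hx
  have hval : KZ.eval (algNF a b c) = 0 := by
    have hk := KZ.relations_le_ker_eval_holds h
    rw [AddMonoidHom.mem_ker, map_sub, hv, zero_sub, neg_eq_zero] at hk
    exact hk
  rw [eval_algNF] at hval
  obtain ⟨h0, h1, h2⟩ := algCoeffs_eq_zero (isAlgebraic_coe a) (isAlgebraic_coe b) (isAlgebraic_coe c) hval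
  have ea : a = 0 := Subtype.ext h0
  have eb : b = 0 := Subtype.ext h1
  have ec : c = 0 := Subtype.ext h2
  subst ea eb ec
  have : x = (x - algNF 0 0 0) + algNF 0 0 0 := by abel
  rw [this]
  exact add_mem h algNF_zero_mem_relations

/-! ### The rational sector embeds: `Π ⊆ Π^alg` modulo relations -/

/-- Every generator of the rational sector `Π` is congruent to a generator of `Π^alg` (same domain,
same integrand). [KontsevichZagier2001 §1.2; this node] -/
theorem pi_bridge : ∀ s ∈ piGens, ∃ t ∈ AddSubgroup.closure algGens, s - t ∈ KZ.relations := by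
  rintro s ((⟨a, rfl⟩ | ⟨b, rfl⟩) | ⟨c, rfl⟩)
  · refine ⟨KZ.of (cstA (ratA a)), AddSubgroup.subset_closure (of_cstA_mem_algGens _), ?_⟩
    exact KZ.of_sub_of_mem_relations_of_eqOn rfl fun x _ => by simp
  · refine ⟨KZ.of (hqA (ratA b)), AddSubgroup.subset_closure (of_hqA_mem_algGens _), ?_⟩
    exact KZ.of_sub_of_mem_relations_of_eqOn rfl fun x _ => by simp [hqRep_integrand]
  · refine ⟨KZ.of (hq2A (ratA c)), AddSubgroup.subset_closure (of_hq2A_mem_algGens _), ?_⟩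
    refine KZ.of_sub_of_mem_relations_of_eqOn rfl fun x _ => ?_
    show (hq2Rep c).integrand x = (ratA c : ℝ) * (hq2Rep 1).integrand x
    rw [hq2Rep_integrand, hq2Rep_integrand, coe_ratA]
    push_cast
    ring

/-- **A quadric in the `Π`-class is in the `Π^alg`-class.** [this node] -/
theorem algDescentAt_of_piDescentAt {d : ℕ} {P : MvPolynomial (Fin d) ℚ} (h : QuadricDescentAt piGens P) :
    QuadricDescentAt algGens P :=
  descentAt_of_bridge pi_bridge h

/-- The 4-ball orthant is in the `Π^alg`-class. [this node] -/
theorem algDescentAt_ball4 : QuadricDescentAt algGens ball4Poly := algDescentAt_of_piDescentAt piDescentAt_ball4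
/-- The paraboloid cell is in the `Π^alg`-class. [this node] -/
theorem algDescentAt_parab4 : QuadricDescentAt algGens parab4Poly := algDescentAt_of_piDescentAt piDescentAt_parab4
/-- The cone cell is in the `Π^alg`-class. [this node] -/
theorem algDescentAt_cone4 : QuadricDescentAt algGens cone4Poly := algDescentAt_of_piDescentAt piDescentAt_cone4
/-- The split quadric is in the `Π^alg`-class, given `EulerKZ`. [this node] -/
theorem algDescentAt_split4_of_eulerKZ (hE : EulerKZ) : QuadricDescentAt algGens split4Poly :=
  algDescentAt_of_piDescentAt (piDescentAt_split4_of_eulerKZ hE)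

/-- **THE MECHANISM on `Π^alg`:** a vanishing `ℤ`-combination of constant-weight quadric cells all of
whose quadrics are in the `Π^alg`-class is a Kontsevich–Zagier relation — NO ORACLE. [this node] -/
theorem sum_mem_relations_alg (k : ℕ) (d : Fin k → ℕ) (P : (i : Fin k) → MvPolynomial (Fin (d i)) ℚ)
    (q : Fin k → ℚ) (ρ : (i : Fin k) → KZ.IntegralRep (d i)) (c : Fin k → ℤ)
    (hW : ∀ i, QuadricDescentAt algGens (P i))
    (hρ : ∀ i, (ρ i).domain = {x | (∀ j, 0 < x j ∧ x j < 1) ∧ 0 < MvPolynomial.aeval x (P i)} ∧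
      ∀ x ∈ (ρ i).domain, (ρ i).integrand x = (q i : ℝ))
    (hdeg : ∀ i, (P i).totalDegree ≤ 2) (hv : KZ.eval (∑ i, c i • KZ.of (ρ i)) = 0) :
    (∑ i, c i • KZ.of (ρ i)) ∈ KZ.relations :=
  sum_mem_relations_of_descentAt algKernel k d P q ρ c hW hρ hdeg hv

end Summit.KontsevichZagierPeriods.RootDecompWalshStrata.PiAlg

end
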